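import Mathlib
import Summits.MatrixMultiplication.Statement
import Summits.MatrixMultiplication.MatrixMultiplication.Theorems.GraphEquationsGenerators
import Summits.MatrixMultiplication.MatrixMultiplication.Theorems.GraphEquationsCubicDictionary

/-!
# GraphEquations — the cubic bridge needs `C3ₙ` only eventually (M45; cell `decomp-mm`, lens-5 g40)

Helper kernel beneath the attacked crux `MultiplicityReduction` (stmt-MatrixMultiplication-27806) of
route `GraphEquations`, rung `K = 3`.

The bridge of `GraphEquationsCubicRung` (`omega_le_of_eqAdmissibleCubic`) consumes `CubicReduction n` for
ALL `n`, so the lens triple of `GraphEquationsCubicDictionary` still carried the undecided finite check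
`CubicReduction 2`.  It need not: reduced admissibility `EqAdmissibleRed β` asks for SOME correct,
generically reduced system of cost `≤ c·n^β` at every `n ≥ 1`, and at each FIXED `n` such systems exist
unconditionally (`GraphEquationsGenerators.eqAdmissibleRed_five_halves`: compute `AB` and subtract); the
finitely many `n < n₀` are absorbed into the constant.  Hence

* `eqAdmissibleRed_of_cubicReduction_eventually (h3 : ∀ n, n₀ ≤ n → CubicReduction n) (hβ : 2 ≤ β) :
  EqAdmissibleCubic β → EqAdmissibleRed β` and `omega_le_of_cubicReduction_eventually`;
* **the rung-3 bridge from affine–quadric rigidity ALONE**: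
  `omega_le_of_affineQuadricRigidity' (hA : ∀ n, 3 ≤ n → AffSystem.AffineQuadricRigidity n) (hβ : 2 ≤ β)
  (h : EqAdmissibleCubic β) : omega ℂ ≤ β` — no hypothesis at `n = 2` (the base range `n ≤ 1` is proved
  anyway, `GraphEquationsCubicBase`; the finite range `n = 2` is now IRRELEVANT to `ω`).

Sorry-free; no stub credit claimed.
-/

set_option linter.dupNamespace false
set_option linter.unusedSectionVars false

noncomputable section

namespace Summit.MatrixMultiplication.MatrixMultiplication.Theorems.GraphEquations

open MvPolynomial Matrix Literature.Computability.AlgebraicComplexity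

variable {n : ℕ}

/-- **Finitely many `n` are free.**  If correct, generically reduced systems of cost `≤ c·n^β` exist for
all `n ≥ n₀`, then `EqAdmissibleRed β` (`β ≥ 0`): below `n₀` use the unconditional reduced systems of
`eqAdmissibleRed_five_halves` and absorb `n₀^{5/2}` into the constant. -/
theorem eqAdmissibleRed_of_eventually {β : ℝ} (hβ : 0 ≤ β) {n₀ : ℕ} {c : ℝ}
    (h : ∀ n : ℕ, n₀ ≤ n → 1 ≤ n → ∃ E : EqSystem n, E.Correct ∧ E.GenericallyReduced ∧
      (E.cost : ℝ) ≤ c * (n : ℝ) ^ β) : EqAdmissibleRed β := by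
  obtain ⟨c', hc'⟩ := eqAdmissibleRed_five_halves
  refine ⟨max c (max c' 0 * (n₀ : ℝ) ^ (5 / 2 : ℝ)), fun n hn => ?_⟩
  have hn1 : (1 : ℝ) ≤ n := by exact_mod_cast hn
  have hnβ : (0 : ℝ) ≤ (n : ℝ) ^ β := Real.rpow_nonneg (by positivity) β
  rcases Nat.lt_or_ge n n₀ with hlt | hge
  · obtain ⟨E, hE, hred, hcost⟩ := hc' n hn
    refine ⟨E, hE, hred, hcost.trans ?_⟩
    have h1 : c' * (n : ℝ) ^ (5 / 2 : ℝ) ≤ max c' 0 * (n : ℝ) ^ (5 / 2 : ℝ) :=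
      mul_le_mul_of_nonneg_right (le_max_left _ _) (Real.rpow_nonneg (by positivity) _)
    have h2 : max c' 0 * (n : ℝ) ^ (5 / 2 : ℝ) ≤ max c' 0 * (n₀ : ℝ) ^ (5 / 2 : ℝ) :=
      mul_le_mul_of_nonneg_left (Real.rpow_le_rpow (by positivity) (by exact_mod_cast hlt.le)
        (by norm_num)) (le_max_right _ _)
    have h3 : max c' 0 * (n₀ : ℝ) ^ (5 / 2 : ℝ) ≤ max c' 0 * (n₀ : ℝ) ^ (5 / 2 : ℝ) * (n : ℝ) ^ β :=
      le_mul_of_one_le_right (mul_nonneg (le_max_right _ _) (Real.rpow_nonneg (by positivity) _))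
        (Real.one_le_rpow hn1 hβ)
    have h4 : max c' 0 * (n₀ : ℝ) ^ (5 / 2 : ℝ) * (n : ℝ) ^ β
        ≤ max c (max c' 0 * (n₀ : ℝ) ^ (5 / 2 : ℝ)) * (n : ℝ) ^ β :=
      mul_le_mul_of_nonneg_right (le_max_right _ _) hnβ
    linarith
  · obtain ⟨E, hE, hred, hcost⟩ := h n hge hn
    exact ⟨E, hE, hred, hcost.trans (mul_le_mul_of_nonneg_right (le_max_left _ _) hnβ)⟩

/-- **`C3ₙ` for `n ≥ n₀` suffices:** cubic admissibility is reduced admissibility. -/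
theorem eqAdmissibleRed_of_cubicReduction_eventually {n₀ : ℕ} (h3 : ∀ n, n₀ ≤ n → CubicReduction n)
    {β : ℝ} (hβ : 0 ≤ β) (h : EqAdmissibleCubic β) : EqAdmissibleRed β := by
  obtain ⟨c, hc⟩ := h
  refine eqAdmissibleRed_of_eventually hβ (n₀ := n₀) (c := c) fun n hn0 hn => ?_
  obtain ⟨E, hE, hcub, hcost⟩ := hc n hn
  exact ⟨E, hE, h3 n hn0 E hE hcub, hcost⟩

/-- **The eventual bridge:** `C3ₙ (n ≥ n₀)` and a cubic admissible `β ≥ 2` give `ω ≤ β`. -/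
theorem omega_le_of_cubicReduction_eventually {n₀ : ℕ} (h3 : ∀ n, n₀ ≤ n → CubicReduction n)
    {β : ℝ} (hβ : 2 ≤ β) (h : EqAdmissibleCubic β) : omega ℂ ≤ β :=
  reducedEquationsForceMultiplication_holds β hβ
    (eqAdmissibleRed_of_cubicReduction_eventually h3 (by linarith) h)

/-- **Rung 3 from affine–quadric rigidity alone** (no hypothesis at `n = 2`): `AQRₙ (n ≥ 3)` and a cubic
admissible `β ≥ 2` give `ω ≤ β`. -/
theorem omega_le_of_affineQuadricRigidity' (hA : ∀ n, 3 ≤ n → AffSystem.AffineQuadricRigidity n)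
    {β : ℝ} (hβ : 2 ≤ β) (h : EqAdmissibleCubic β) : omega ℂ ≤ β :=
  omega_le_of_cubicReduction_eventually (n₀ := 3)
    (fun n hn => cubicReduction_of_affineQuadricRigidity hn (hA n hn)) hβ h

/-- The same in the route's currency `EqAdmissibleRed`. -/
theorem eqAdmissibleRed_of_affineQuadricRigidity' (hA : ∀ n, 3 ≤ n → AffSystem.AffineQuadricRigidity n)
    {β : ℝ} (hβ : 0 ≤ β) (h : EqAdmissibleCubic β) : EqAdmissibleRed β :=
  eqAdmissibleRed_of_cubicReduction_eventually (n₀ := 3)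
    (fun n hn => cubicReduction_of_affineQuadricRigidity hn (hA n hn)) hβ h

end Summit.MatrixMultiplication.MatrixMultiplication.Theorems.GraphEquations

end
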